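import Summits.AtomisticToContinuum.FouriersLaw.Theses.ContactEchoEpochs
import Summits.AtomisticToContinuum.FouriersLaw.Theorems.PhononMeanFreePathIncoherentBoundedContactBound
import Summits.AtomisticToContinuum.FouriersLaw.Theorems.PhononMeanFreePathIncoherentBoundedCurrentKubo

/-!
# `ContactEchoEpochs.EchoBounds` — the fixed-`N` sanity anchor `0 ≤ ∫₀^∞ c_N ≤ γT²/2`, proved

Closes item `stmt-AtomisticToContinuum-11823` — the support decl `EchoBounds` of the route
`Summits/AtomisticToContinuum/FouriersLaw/Theses/ContactEchoEpochs`: for the pinned anharmonic chain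
`pinnedChain ω₂ lam β γ` (all parameters positive) with `N = n + 2` sites, both Langevin baths at `T > 0`
(`μ_T = gibbsMeasure (n+2) T`, `P_t = transitionKernel (n+2) T T t`, the CONSTRUCTED kernels), contact powers
`w_L = γ(T - p₀²)`, `w_R = γ(T - p_{N-1}²)` and contact echo `c_N(t) = ∫ w_L · (P_t w_R) dμ_T`:
`0 ≤ ∫₀^∞ c_N ≤ γT²/2`, i.e. `0 ≤ G_N ≤ γ/2` (`echoBounds_proof`).

Proof. Pointwise in `t`, `c_N(t) = γ² · ∫ (p₀² - T) · P_t(p_{N-1}² - T) dμ_T` (`EchoBounds.contactEcho_eq`: linearity of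
the two Bochner integrals, no integrability needed), and the cross kinetic kernel on the right is exactly the kernel
`C_N` of the `IncoherentBounded` helpers of route `PhononMeanFreePath`, for which the tree PROVES, for every length,
`0 ≤ ∫₀^∞ C` (`IncoherentBounded.integral_kinCorr_cross_nonneg`: Green–Kubo positivity of the total-current
autocorrelation + the current–current form `∫₀^∞⟨J, P_s J⟩ = γ²(N-1)²∫₀^∞ C`) and `∫₀^∞ C ≤ T²/(2γ)`
(`IncoherentBounded.integral_kinCorr_cross_le`: Green–Kubo positivity for `θ₀ - θ_{N-1}`, the two single-bath sum
rules `γ(∫A + ∫C) = T²` and time reversal `C' = C`). Multiplying by `γ²` gives the item; its integrability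
hypothesis is not used (the tree has `IncoherentBounded.kinCorr_integrableOn`).
-/

noncomputable section

open MeasureTheory ProbabilityTheory Filter Topology Set
open scoped NNReal ENNReal
open Literature.MathematicalPhysics.KineticTheory.HeatConduction
open Literature.MathematicalPhysics.KineticTheory OscillatorChain

namespace Summit.AtomisticToContinuum.FouriersLaw.Theorems

namespace EchoBounds

/-- **The contact echo is `γ²` times the cross kinetic kernel**, pointwise in time and for ANY kernel / measure:
`∫ γ(T - p₀²) · (∫ γ(T - p_{n+1}²) dK) dμ = γ² ∫ (p₀² - T) · (∫ (p_{n+1}² - T) dK) dμ` (linearity of the Bochner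
integral; both sides are junk `0` together). [folklore] -/
theorem contactEcho_eq {n : ℕ} (γ T : ℝ) (K : PhaseSpace (n + 2) → Measure (PhaseSpace (n + 2)))
    (μ : Measure (PhaseSpace (n + 2))) :
    (∫ z, γ * (T - (z.2 0) ^ 2) * (∫ y, γ * (T - (y.2 (Fin.last (n + 1))) ^ 2) ∂(K z)) ∂μ) =
      γ ^ 2 * ∫ z, ((z.2 0) ^ 2 - T) * (∫ y, ((y.2 (Fin.last (n + 1))) ^ 2 - T) ∂(K z)) ∂μ := by
  rw [← integral_const_mul]
  refine integral_congr_ae (Eventually.of_forall fun z => ?_)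
  have hK : (∫ y, γ * (T - (y.2 (Fin.last (n + 1))) ^ 2) ∂(K z)) =
      -γ * ∫ y, ((y.2 (Fin.last (n + 1))) ^ 2 - T) ∂(K z) := by
    rw [← integral_const_mul]
    refine integral_congr_ae (Eventually.of_forall fun y => ?_)
    ring
  simp only [hK]
  ring

end EchoBounds

open Summit.AtomisticToContinuum.FouriersLaw.Theorems.IncoherentBounded in
/-- **EchoBounds — `0 ≤ ∫₀^∞ c_N ≤ γT²/2` at every fixed `N ≥ 2`.** For `pinnedChain ω₂ lam β γ`
(`ω₂, lam, β, γ > 0`), `T > 0` and `N = n + 2` sites, the time-integrated contact-to-contact power echo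
`∫_{t>0} ∫ γ(T - p₀²) · P_t(γ(T - p_{N-1}²)) dμ_T dt` lies in `[0, γT²/2]` (equivalently `0 ≤ G_N ≤ γ/2`): it is `γ²`
times the cross kinetic Green–Kubo integral `∫₀^∞ C`, and `0 ≤ ∫₀^∞ C ≤ T²/(2γ)` for every length
(`IncoherentBounded.integral_kinCorr_cross_nonneg`, `IncoherentBounded.integral_kinCorr_cross_le`). The integrability
hypothesis of the item is not needed. [cite: KunduDharNarayan2009, arXiv:0809.4543 p. 3] -/
theorem echoBounds_proof : Summit.AtomisticToContinuum.FouriersLaw.Theses.ContactEchoEpochs.EchoBounds := by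
  intro ω₂ lam β γ hω hl hβ hγ T hT n _
  have hc : (fun t : ℝ => ∫ z, γ * (T - (z.2 0) ^ 2) * (∫ y, γ * (T - (y.2 (Fin.last (n + 1))) ^ 2)
      ∂((pinnedChain ω₂ lam β γ).transitionKernel (n + 2) T T (Real.toNNReal t) z))
      ∂((pinnedChain ω₂ lam β γ).gibbsMeasure (n + 2) T)) =
      fun t : ℝ => γ ^ 2 * ∫ z, ((z.2 0) ^ 2 - T) * (∫ y, ((y.2 (Fin.last (n + 1))) ^ 2 - T)
        ∂((pinnedChain ω₂ lam β γ).transitionKernel (n + 2) T T (Real.toNNReal t) z))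
        ∂((pinnedChain ω₂ lam β γ).gibbsMeasure (n + 2) T) :=
    funext fun t => EchoBounds.contactEcho_eq γ T _ _
  rw [hc, integral_const_mul]
  -- the cross kinetic Green–Kubo integral lies in `[0, T²/(2γ)]`
  have h0 : 0 ≤ ∫ t in Ioi (0 : ℝ), ∫ z, ((z.2 0) ^ 2 - T) * (∫ y, ((y.2 (Fin.last (n + 1))) ^ 2 - T)
      ∂((pinnedChain ω₂ lam β γ).transitionKernel (n + 2) T T (Real.toNNReal t) z))
      ∂((pinnedChain ω₂ lam β γ).gibbsMeasure (n + 2) T) :=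
    integral_kinCorr_cross_nonneg hω hl.le hβ hγ hT (N := n + 1) (by omega)
  have h1 : ∫ t in Ioi (0 : ℝ), ∫ z, ((z.2 0) ^ 2 - T) * (∫ y, ((y.2 (Fin.last (n + 1))) ^ 2 - T)
      ∂((pinnedChain ω₂ lam β γ).transitionKernel (n + 2) T T (Real.toNNReal t) z))
      ∂((pinnedChain ω₂ lam β γ).gibbsMeasure (n + 2) T) ≤ T ^ 2 / (2 * γ) := by
    have h := integral_kinCorr_cross_le hω hl.le hβ hγ (n := n + 2) (by omega) hT
    have ha : (⟨0, by omega⟩ : Fin (n + 2)) = 0 := rfl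
    have hb : (⟨n + 2 - 1, by omega⟩ : Fin (n + 2)) = Fin.last (n + 1) := rfl
    rw [ha, hb] at h
    exact h
  have hg2 : 0 ≤ γ ^ 2 := sq_nonneg γ
  refine ⟨mul_nonneg hg2 h0, ?_⟩
  calc γ ^ 2 * _ ≤ γ ^ 2 * (T ^ 2 / (2 * γ)) := mul_le_mul_of_nonneg_left h1 hg2
    _ = γ * T ^ 2 / 2 := by field_simp
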